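import Literature.Combinatorics.Optimization.DensityMatricesPolyhedralApproximation
import HarnessLib

/-!
# Fawzi 2021, Theorem 1 for the elliptope: no small LP approximates `{X ⪰ 0, X_ii = 1/n}` around any centre

H. Fawzi, *On polyhedral approximations of the positive semidefinite cone*, Math. Oper. Res. 46
(2021) 1479–1489 = arXiv:1811.09649 [Fawzi2021], p. 4 (first bullet): "Theorems 1 and 2 are also true
(with the same proof) if we replace `D` with the (scaled) elliptope
`E = {X ∈ S^n : X ⪰ 0 and X_ii = 1/n ∀ i = 1,…,n} ⊂ D`. This is because the matrix we consider in
Equation (3.3) is also a submatrix of the slack matrix of the elliptope", together with Remark 1 (p. 6)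
("If we consider the elliptope `E` instead of `D` … Assume `A` is a symmetric matrix of trace equal to
one, and assume that `(1-ε)(E - A) ⊂ P ⊂ E - A` … Thus if `xc(Q) ≥ e^{c√n}` we get that
`xc(P) ≥ e^{c'√n}`").  The (scaled) elliptope is the feasible region of the basic MAX-CUT semidefinite
relaxation (unit-diagonal psd matrices); the statement says that it has no `(1-ε)`-approximate LINEAR
extended formulation of size `< e^{c√n}` — a companion, on the SDP side, of the LP lower bounds for
MAX-CUT of [KothariMekaRaghavendra2017] in this directory.

THIS FILE PROVES the elliptope version of Theorem 1 (`Fawzi2021_thm1_elliptope`) for an arbitrary real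
symmetric centre `A` of trace one, 0 facts.  PROOF (deviation from Remark 1 recorded): instead of the
printed reduction `A ↦ diag(A) ↦ I/n` by sign and cyclic conjugations (which needs the bound
`xc(∑ᵢ Pᵢ) ≤ ∑ᵢ xc(Pᵢ)` for Minkowski sums of general slack-form EFs, not in the tree), we compute the
slack of the sandwiched pair on the STANDARD hypercube `y_t = σ(t)/√n` directly: the points
`(1-ε)(y_s y_sᵀ - A) ∈ (1-ε)(E - A)` against the inequalities `⟨I - n y_t y_tᵀ, Z⟩ ≤ a(t)`,
`a(t) = n·y_tᵀ A y_t`, valid on `E - A`, have slack `(1-ε)(σ_sᵀσ_t)²/n + ε a(t)` — the COLUMN-WEIGHTED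
kernel `Fawzi2021.quadKernelW n ε a` with `∑_t a(t) = 2^n Tr A = 2^n` — and
`Fawzi2021.quadKernelW_nonnegRank` (file `QuadraticKernelNonnegativeRank.lean`, the printed §3 argument
run on the light columns) bounds the size of any nonnegative factorization of it by `e^{c√n}` from
below.  For `A = I/n` the weight is `a ≡ 1` and the slack is literally the matrix (3.3).

Definitions (with bodies): `ellSet`, `stdCubeVec`, `colWeight`, `testVecStd`, `pointVecStd`; no named
facts.  Theorem 2 for the elliptope (Gaussian width) is NOT typed (see the companion file).
-/

noncomputable section

namespace Literature.Combinatorics.Optimization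

namespace Fawzi2021

open Finset Matrix Real
open scoped Pointwise
open Literature.Probability.RandomGraphs.LowDegree (sgn sgn_mul_self)
open Literature.Barriers.PneNP (HasEFOfSize)

variable {n : ℕ}

/-! ### The scaled elliptope -/

/-- **The (scaled) elliptope** `E = {X ∈ S^n : X ⪰ 0, X_ii = 1/n ∀ i}` as a subset of `ℝ^{n×n}`.
[cite: Fawzi2021, §1 (p. 4: "`E = {X ∈ S^n : X ⪰ 0 and X_ii = 1/n ∀i=1,…,n} ⊂ D`")] -/
def ellSet (n : ℕ) : Set (Fin n × Fin n → ℝ) :=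
  {X | (mat X).PosSemidef ∧ ∀ i, X (i, i) = 1 / n}

/-- Membership in `E`, unfolded. [cite: Fawzi2021, §1 (p. 4)] -/
theorem mem_ellSet {X : Fin n × Fin n → ℝ} :
    X ∈ ellSet n ↔ (mat X).PosSemidef ∧ ∀ i, X (i, i) = 1 / n := Iff.rfl

/-- Elements of the elliptope have trace one (`n ≥ 1`). [cite: Fawzi2021, §1 (p. 4: "`E ⊂ D`")] -/
theorem trace_mat_of_mem_ellSet (hn : 1 ≤ n) {X : Fin n × Fin n → ℝ} (hX : X ∈ ellSet n) :
    (mat X).trace = 1 := by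
  have hnpos : (0 : ℝ) < n := by exact_mod_cast hn
  rw [Matrix.trace]
  have e : ∀ i, Matrix.diag (mat X) i = 1 / n := fun i => hX.2 i
  simp_rw [e, sum_const, card_univ, Fintype.card_fin, nsmul_eq_mul]
  field_simp

/-- **`E ⊂ D`** (`n ≥ 1`). [cite: Fawzi2021, §1 (p. 4)] -/
theorem ellSet_subset_denSet (hn : 1 ≤ n) : ellSet n ⊆ denSet n :=
  fun _ hX => ⟨hX.1, trace_mat_of_mem_ellSet hn hX⟩

/-! ### The standard hypercube `{±1/√n}^n` -/

/-- The standard hypercube point `y_t = σ(t)/√n ∈ {-1/√n, +1/√n}^n`.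
[cite: Fawzi2021, §3 (p. 6: "the submatrix indexed by elements of the hypercube `{-1/√n, +1/√n}^n`")] -/
def stdCubeVec (t : Fin n → Bool) : Fin n → ℝ := fun i => sgn (t i) / Real.sqrt n

/-- `y_sᵀ y_t = σ_sᵀσ_t / n`. [cite: Fawzi2021, §3 (p. 6)] -/
theorem stdCubeVec_dotProduct (hn : 1 ≤ n) (s t : Fin n → Bool) :
    stdCubeVec s ⬝ᵥ stdCubeVec t = ip s t / n := by
  have hnpos : (0 : ℝ) < n := by exact_mod_cast hn
  have hsq : Real.sqrt (n : ℝ) ^ 2 = n := Real.sq_sqrt hnpos.le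
  unfold stdCubeVec ip dotProduct
  rw [sum_div]
  refine sum_congr rfl fun i _ => ?_
  rw [div_mul_div_comm, ← sq, hsq]

/-- `‖y_t‖² = 1`. [cite: Fawzi2021, §3 (p. 6)] -/
theorem stdCubeVec_dotProduct_self (hn : 1 ≤ n) (t : Fin n → Bool) : stdCubeVec t ⬝ᵥ stdCubeVec t = 1 := by
  have hnpos : (0 : ℝ) < n := by exact_mod_cast hn
  rw [stdCubeVec_dotProduct hn, ip_self, div_self hnpos.ne']

/-- **Hypercube points are in the elliptope**: `y_t y_tᵀ ∈ E` (its diagonal entries are `σᵢ²/n = 1/n`).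
[cite: Fawzi2021, §1 (p. 4: "the matrix (3.3) is also a submatrix of the slack matrix of the elliptope")] -/
theorem vec_vecMulVec_stdCubeVec_mem_ellSet (hn : 1 ≤ n) (t : Fin n → Bool) :
    vec (vecMulVec (stdCubeVec t) (stdCubeVec t)) ∈ ellSet n := by
  have hnpos : (0 : ℝ) < n := by exact_mod_cast hn
  have hsq : Real.sqrt (n : ℝ) ^ 2 = n := Real.sq_sqrt hnpos.le
  refine ⟨(vec_vecMulVec_mem_denSet (stdCubeVec_dotProduct_self hn t)).1, fun i => ?_⟩
  unfold vec stdCubeVec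
  simp only [vecMulVec_apply]
  rw [div_mul_div_comm, sgn_mul_self, ← sq, hsq]

/-! ### The column weight `a(t) = n · y_tᵀ A y_t` -/

/-- The column weight `a(t) = n·y_tᵀ A y_t = ∑ᵢⱼ Aᵢⱼ σᵢ(t)σⱼ(t)` (for `A = I/n`, `a ≡ 1`).
[cite: Fawzi2021, Remark 1 (p. 6)] -/
def colWeight (A : Matrix (Fin n) (Fin n) ℝ) (t : Fin n → Bool) : ℝ :=
  (n : ℝ) * (stdCubeVec t ⬝ᵥ (A *ᵥ stdCubeVec t))

/-- `a(t) = ∑ᵢⱼ Aᵢⱼ σᵢσⱼ` (`n ≥ 1`). [cite: Fawzi2021, Remark 1 (p. 6)] -/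
theorem colWeight_eq (hn : 1 ≤ n) (A : Matrix (Fin n) (Fin n) ℝ) (t : Fin n → Bool) :
    colWeight A t = ∑ i, ∑ j, A i j * (sgn (t i) * sgn (t j)) := by
  have hnpos : (0 : ℝ) < n := by exact_mod_cast hn
  have hsq : Real.sqrt (n : ℝ) ^ 2 = n := Real.sq_sqrt hnpos.le
  have hs0 : Real.sqrt (n : ℝ) ≠ 0 := (Real.sqrt_pos.2 hnpos).ne'
  unfold colWeight stdCubeVec dotProduct mulVec dotProduct
  rw [mul_sum]
  refine sum_congr rfl fun i _ => ?_
  rw [mul_sum, mul_sum]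
  refine sum_congr rfl fun j _ => ?_
  field_simp
  rw [hsq]
  ring

/-- **The column weights have total `2^n Tr A`**: `∑_t a(t) = 2^n ∑ᵢ Aᵢᵢ` (the off-diagonal terms
average out over the cube). [cite: Fawzi2021, Remark 1 (p. 6: "`∑ᵢ λᵢ diag(xᵢ) A diag(xᵢ) = diag(A)`")] -/
theorem sum_colWeight (hn : 1 ≤ n) (A : Matrix (Fin n) (Fin n) ℝ) :
    ∑ t : Fin n → Bool, colWeight A t = 2 ^ n * A.trace := by
  simp_rw [colWeight_eq hn]
  rw [sum_comm]
  simp_rw [sum_comm (s := (univ : Finset (Fin n → Bool))), ← mul_sum, sum_sgn_mul_sgn, mul_ite, mul_zero]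
  rw [Matrix.trace, mul_sum]
  refine sum_congr rfl fun i _ => ?_
  rw [sum_ite_eq]
  simp [Matrix.diag, mul_comm]

/-! ### The slack of the sandwiched pair on the standard hypercube -/

section Slack

variable (A : Matrix (Fin n) (Fin n) ℝ)

/-- The test matrices `I - n y_t y_tᵀ` in the standard basis. [cite: Fawzi2021, §3 (p. 6) and Remark 1] -/
def testVecStd (t : Fin n → Bool) : Fin n × Fin n → ℝ :=
  vec ((1 : Matrix (Fin n) (Fin n) ℝ) - (n : ℝ) • vecMulVec (stdCubeVec t) (stdCubeVec t))

/-- The hypercube points of `(1-ε)(E - A)`: `(1-ε)(y_s y_sᵀ - A)`. [cite: Fawzi2021, §3 (p. 6) and Remark 1] -/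
def pointVecStd (ε : ℝ) (s : Fin n → Bool) : Fin n × Fin n → ℝ :=
  (1 - ε) • (vec (vecMulVec (stdCubeVec s) (stdCubeVec s)) - vec A)

/-- `⟨I - n y_t y_tᵀ, X - A⟩ = Tr X - Tr A - n y_tᵀ X y_t + a(t)`. [cite: Fawzi2021, §3 (p. 6, slack computation)] -/
theorem testVecStd_dotProduct_sub (t : Fin n → Bool) (X : Fin n × Fin n → ℝ) :
    testVecStd t ⬝ᵥ (X - vec A) =
      (mat X).trace - A.trace - (n : ℝ) * (stdCubeVec t ⬝ᵥ (mat X *ᵥ stdCubeVec t)) + colWeight A t := by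
  unfold testVecStd colWeight
  conv_lhs => rw [← vec_mat X]
  rw [vec_sub, vec_smul, ← vec_sub, sub_dotProduct, smul_dotProduct, vec_sub, dotProduct_sub,
    dotProduct_sub, vec_one_dotProduct_vec, vec_one_dotProduct_vec, vec_vecMulVec_dotProduct_vec,
    vec_vecMulVec_dotProduct_vec, smul_eq_mul]
  ring

/-- **Validity on `E - A`**: `⟨I - n y_t y_tᵀ, Z⟩ ≤ a(t)` for `Z ∈ E - A` (it equals `a(t) - n y_tᵀ X y_t`
with `X ⪰ 0`, as `Tr X = Tr A = 1`). [cite: Fawzi2021, §3 (p. 6) and Remark 1 (p. 6)] -/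
theorem testVecStd_dotProduct_le (htr : A.trace = 1) (hn : 1 ≤ n) (t : Fin n → Bool)
    {Z : Fin n × Fin n → ℝ} (hZ : Z ∈ ellSet n - {vec A}) : testVecStd t ⬝ᵥ Z ≤ colWeight A t := by
  obtain ⟨X, hX, B, hB, rfl⟩ := Set.mem_sub.1 hZ
  rw [Set.mem_singleton_iff] at hB
  subst hB
  have hnpos : (0 : ℝ) < n := by exact_mod_cast hn
  rw [testVecStd_dotProduct_sub, htr, trace_mat_of_mem_ellSet hn hX]
  have hpsd : 0 ≤ stdCubeVec t ⬝ᵥ (mat X *ᵥ stdCubeVec t) := by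
    have := hX.1.dotProduct_mulVec_nonneg (stdCubeVec t)
    simpa using this
  nlinarith

/-- **The points lie in `(1-ε)(E - A)`**. [cite: Fawzi2021, Remark 1 (p. 6)] -/
theorem pointVecStd_mem (hn : 1 ≤ n) (ε : ℝ) (s : Fin n → Bool) :
    pointVecStd A ε s ∈ (1 - ε) • (ellSet n - {vec A}) := by
  unfold pointVecStd
  exact Set.smul_mem_smul_set (Set.sub_mem_sub (vec_vecMulVec_stdCubeVec_mem_ellSet hn s)
    (Set.mem_singleton _))

/-- **The slack is the column-weighted kernel**: `a(t) - ⟨I - n y_t y_tᵀ, (1-ε)(y_s y_sᵀ - A)⟩ =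
(1-ε)(σ_sᵀσ_t)²/n + ε a(t)`. [cite: Fawzi2021, §3 eq. (3.3) (p. 6) and Remark 1 (p. 6)] -/
theorem colWeight_sub_testVecStd_dotProduct_pointVecStd (htr : A.trace = 1) (hn : 1 ≤ n) (ε : ℝ)
    (s t : Fin n → Bool) :
    colWeight A t - testVecStd t ⬝ᵥ pointVecStd A ε s = quadKernelW n ε (colWeight A) s t := by
  have hnpos : (0 : ℝ) < n := by exact_mod_cast hn
  unfold pointVecStd
  rw [dotProduct_smul, smul_eq_mul, testVecStd_dotProduct_sub, mat_vec, trace_vecMulVec,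
    stdCubeVec_dotProduct_self hn, htr, dotProduct_vecMulVec_mulVec, stdCubeVec_dotProduct hn,
    quadKernelW_apply]
  field_simp
  ring

/-- **Generalized Yannakakis on the standard hypercube**: an extended formulation of size `r` of any
`P` with `(1-ε)(E - A) ⊆ P ⊆ E - A` yields a nonnegative factorization of the column-weighted kernel
of size `r + 1`. [cite: Fawzi2021, Thm. 4 (§2.2, p. 5) and Remark 1 (p. 6)] -/
theorem hasNonnegFactorization_quadKernelW_of_hasEF (htr : A.trace = 1) (hn : 1 ≤ n) {ε : ℝ}
    {P : Set (Fin n × Fin n → ℝ)} (hin : (1 - ε) • (ellSet n - {vec A}) ⊆ P)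
    (hout : P ⊆ ellSet n - {vec A}) {r : ℕ} (hP : HasEFOfSize P r) :
    HasNonnegFactorization (quadKernelW n ε (colWeight A)) (r + 1) := by
  obtain ⟨U, V, hU, hV, hfac⟩ := hP.exists_nonneg_factorisation (A := Fin n → Bool) (B := Fin n → Bool)
    (fun s => pointVecStd A ε s) (fun s => hin (pointVecStd_mem A hn ε s)) (fun t => testVecStd t)
    (fun t => colWeight A t) (fun t Z hZ => testVecStd_dotProduct_le A htr hn t (hout hZ))
  refine ⟨fun s l => V (finSuccEquiv r l) s, fun l t => U t (finSuccEquiv r l), fun s l => hV _ _,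
    fun l t => hU _ _, fun s t => ?_⟩
  simp only
  rw [← colWeight_sub_testVecStd_dotProduct_pointVecStd A htr hn ε s t, hfac t s]
  exact (Fintype.sum_equiv (finSuccEquiv r) (fun l => V (finSuccEquiv r l) s * U t (finSuccEquiv r l))
    (fun l => U t l * V l s) fun l => by ring).symm

end Slack

/-! ### Theorem 1 for the elliptope -/

/-- **Fawzi 2021, Theorem 1 with the elliptope in place of `D`** ("Theorems 1 and 2 are also true
(with the same proof) if we replace `D` with the (scaled) elliptope `E`"; Remark 1: "assume `A` is a
symmetric matrix of trace equal to one, and assume that `(1-ε)(E - A) ⊂ P ⊂ E - A` … we get that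
`xc(P) ≥ e^{c'√n}`"): for every `0 < ε < 1` there are `c > 0` and `n₀` such that for all `n ≥ n₀`,
every real symmetric `A` with `Tr A = 1`, every `P ⊆ ℝ^{n×n}` with `(1-ε) • (E - {A}) ⊆ P ⊆ E - {A}`
and every slack-form extended formulation of `P` with `r` inequalities, `e^{c√n} ≤ r`.  (The symmetry
of `A` is part of the printed statement; the proof does not use it, since `yᵀAy` only sees the
symmetric part of `A`.)
[cite: Fawzi2021, Thm. 1 (p. 3) with p. 4 (elliptope) and Remark 1 (p. 6)] -/
theorem _root_.Literature.Combinatorics.Optimization.Fawzi2021_thm1_elliptope {ε : ℝ} (hε0 : 0 < ε)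
    (hε1 : ε < 1) :
    ∃ c : ℝ, 0 < c ∧ ∃ n₀ : ℕ, ∀ n : ℕ, n₀ ≤ n →
      ∀ A : Matrix (Fin n) (Fin n) ℝ, A.IsSymm → A.trace = 1 →
      ∀ P : Set (Fin n × Fin n → ℝ),
        (1 - ε) • (ellSet n - {vec A}) ⊆ P → P ⊆ ellSet n - {vec A} →
        ∀ r : ℕ, HasEFOfSize P r → Real.exp (c * Real.sqrt n) ≤ r := by
  obtain ⟨c₀, hc₀, n₀, hmain⟩ := quadKernelW_nonnegRank hε0 hε1
  refine ⟨c₀ / 2, by positivity, max n₀ (max 1 ⌈(2 / c₀) ^ 2⌉₊), fun n hn A _hsymm htr P hin hout r hP => ?_⟩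
  have hn₀ : n₀ ≤ n := le_trans (le_max_left _ _) hn
  have hn1 : 1 ≤ n := le_trans (le_max_left _ _) ((le_max_right _ _).trans hn)
  have hnc : (2 / c₀) ^ 2 ≤ (n : ℝ) :=
    (Nat.le_ceil _).trans (by exact_mod_cast (le_max_right _ _).trans ((le_max_right _ _).trans hn))
  have hfac := hasNonnegFactorization_quadKernelW_of_hasEF A htr hn1 hin hout hP
  have hsum : ∑ t, colWeight A t ≤ 2 ^ n := by rw [sum_colWeight hn1, htr, mul_one]
  have h1 := hmain n hn₀ (colWeight A) hsum (r + 1) hfac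
  push_cast at h1
  set E : ℝ := Real.exp (c₀ / 2 * Real.sqrt n) with hE
  have hsqrt : 2 / c₀ ≤ Real.sqrt n := by
    rw [← Real.sqrt_sq (div_pos two_pos hc₀).le]
    exact Real.sqrt_le_sqrt hnc
  have hE2 : 2 ≤ E := by
    have h2 : 2 ≤ Real.sqrt n * c₀ := (div_le_iff₀ hc₀).1 hsqrt
    have h3 : (1 : ℝ) ≤ c₀ / 2 * Real.sqrt n := by
      have : c₀ / 2 * Real.sqrt n = Real.sqrt n * c₀ / 2 := by ring
      rw [this]; linarith
    have h4 : (2 : ℝ) ≤ c₀ / 2 * Real.sqrt n + 1 := by linarith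
    exact h4.trans (Real.add_one_le_exp _)
  have hEE : Real.exp (c₀ * Real.sqrt n) = E * E := by
    rw [hE, ← Real.exp_add]; congr 1; ring
  rw [hEE] at h1
  nlinarith

end Fawzi2021

end Literature.Combinatorics.Optimization

end
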